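import Summits.QuantumFields.QCD.Theorems.SmallFieldUltracontractivity.Negative.Tightness
import Literature.MathematicalPhysics.QuantumLattice.LatticeToriProofs

/-!
# Auxiliary file for stub `stub_commutatorBound` of line `point-centred-axial-parabolic`
(crux `Summit.QuantumFields.QCD.Theses.HeatSlicedQuarks.SmallFieldUltracontractivity`, item stmt-QuantumFields-8871)

Discrete calculus of the product cutoff `χ(z) = ∏_ν f(c_ν(z - x)/N)` of the line's cut-off Duhamel
parametrix (`x` a centre of the four-torus `(ℤ/L)⁴`, `N` a scale, `c_ν(w) = min (w_ν, L - w_ν)` the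
cyclic distance of a coordinate, `f(u) = (max 0 (1 - (max 0 (u - 1))²))²` a `C^{1,1}` profile):
`cut_taylor` (`|f(w) - f(v) - f'(v)(w - v)| ≤ 4(w - v)²`, nine polynomial cases) bounds differences
of `f`, `cyc_trichotomy` transports them to one coordinate `g = f(c/N)` (`4N + 3 ≤ L`), and peeling
coordinates off the product gives the registered summary `stub_commutatorBoundAux`.
-/

noncomputable section

namespace Summit.QuantumFields.QCD.Cruxes.SmallFieldUltracontractivity.PointCentredAxialParabolic

open Literature.MathematicalPhysics.QuantumLattice Literature.MathematicalPhysics.QuantumFieldTheory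
open Literature.Probability.LatticeModels (TorusSite)

namespace CommutatorBound

/-- Left region `u ≤ 1`: `f = 1`, `f' = 0`. -/
theorem cut_left {u : ℝ} (hu : u ≤ 1) : (max 0 (1 - (max 0 (u - 1)) ^ 2)) ^ 2 = 1 ∧
    -4 * max 0 (u - 1) * max 0 (1 - (max 0 (u - 1)) ^ 2) = 0 := by
  rw [show max 0 (u - 1) = 0 from max_eq_left (by linarith)]; norm_num

/-- Middle region `1 ≤ u ≤ 2`: `f = (1 - (u-1)²)²`, `f' = -4(u-1)(1 - (u-1)²)`. -/
theorem cut_mid {u : ℝ} (hu : 1 ≤ u) (hu2 : u ≤ 2) :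
    (max 0 (1 - (max 0 (u - 1)) ^ 2)) ^ 2 = (1 - (u - 1) ^ 2) ^ 2 ∧
      -4 * max 0 (u - 1) * max 0 (1 - (max 0 (u - 1)) ^ 2) = -4 * (u - 1) * (1 - (u - 1) ^ 2) := by
  rw [show max 0 (u - 1) = u - 1 from max_eq_right (by linarith), show max 0 (1 - (u - 1) ^ 2) =
    1 - (u - 1) ^ 2 from max_eq_right (by nlinarith)]; exact ⟨rfl, rfl⟩

/-- Right region `2 ≤ u`: `f = 0`, `f' = 0`. -/
theorem cut_right {u : ℝ} (hu : 2 ≤ u) : (max 0 (1 - (max 0 (u - 1)) ^ 2)) ^ 2 = 0 ∧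
    -4 * max 0 (u - 1) * max 0 (1 - (max 0 (u - 1)) ^ 2) = 0 := by
  rw [show max 0 (u - 1) = u - 1 from max_eq_right (by linarith),
    show max 0 (1 - (u - 1) ^ 2) = 0 from max_eq_left (by nlinarith)]; norm_num

/-- **Taylor bound** `|f(w) - f(v) - f'(v)(w - v)| ≤ 4 (w - v)²` (`f'` is `8`-Lipschitz). -/
theorem cut_taylor (v w : ℝ) :
    |(max 0 (1 - (max 0 (w - 1)) ^ 2)) ^ 2 - (max 0 (1 - (max 0 (v - 1)) ^ 2)) ^ 2 -
        -4 * max 0 (v - 1) * max 0 (1 - (max 0 (v - 1)) ^ 2) * (w - v)| ≤ 4 * (w - v) ^ 2 := by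
  rw [abs_le]
  rcases le_total v 1 with hv | hv
  · rw [(cut_left hv).1, (cut_left hv).2]
    rcases le_total w 1 with hw | hw
    · rw [(cut_left hw).1]; constructor <;> nlinarith
    rcases le_total w 2 with hw2 | hw2
    · rw [(cut_mid hw hw2).1]
      have ht : (w - 1) ^ 2 ≤ 1 := by nlinarith
      have hvw : (w - 1) ^ 2 ≤ (w - v) ^ 2 := pow_le_pow_left₀ (by linarith) (by linarith) 2
      constructor <;> nlinarith [mul_le_mul_of_nonneg_left ht (sq_nonneg (w - 1)),
        sq_nonneg (w - v), sq_nonneg (w - 1)]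
    · rw [(cut_right hw2).1]; constructor <;> nlinarith
  rcases le_total v 2 with hv2 | hv2
  · rw [(cut_mid hv hv2).1, (cut_mid hv hv2).2]
    obtain ⟨hs0, hs1⟩ : 0 ≤ v - 1 ∧ v - 1 ≤ 1 := ⟨by linarith, by linarith⟩
    rcases le_total w 1 with hw | hw
    · rw [(cut_left hw).1]
      have hd : v - 1 ≤ v - w := by linarith
      constructor <;> nlinarith [mul_nonneg hs0 hs0, mul_nonneg (mul_nonneg hs0 hs0)
        (sub_nonneg.2 hs1), mul_nonneg hs0 (sub_nonneg.2 hd),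
        mul_nonneg (mul_nonneg hs0 hs0) (mul_nonneg hs0 (sub_nonneg.2 hd))]
    rcases le_total w 2 with hw2 | hw2
    · rw [(cut_mid hw hw2).1, show (1 - (w - 1) ^ 2) ^ 2 - (1 - (v - 1) ^ 2) ^ 2 -
          -4 * (v - 1) * (1 - (v - 1) ^ 2) * (w - v) =
          (w - v) ^ 2 * ((w - 1) ^ 2 + 2 * (v - 1) * (w - 1) + 3 * (v - 1) ^ 2 - 2) by ring]
      have ht0 : 0 ≤ w - 1 := by linarith
      have hb1 : (w - 1) ^ 2 + 2 * (v - 1) * (w - 1) + 3 * (v - 1) ^ 2 - 2 ≤ 4 := by nlinarith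
      have hb2 : -2 ≤ (w - 1) ^ 2 + 2 * (v - 1) * (w - 1) + 3 * (v - 1) ^ 2 - 2 := by nlinarith
      constructor <;> nlinarith [sq_nonneg (w - v), mul_le_mul_of_nonneg_left hb1
        (sq_nonneg (w - v)), mul_le_mul_of_nonneg_left hb2 (sq_nonneg (w - v))]
    · rw [(cut_right hw2).1]
      obtain ⟨e, he0, he⟩ : ∃ e, 0 ≤ e ∧ w - v = (2 - v) + e := 
        ⟨w - v - (2 - v), by linarith, by ring⟩
      rw [he]
      constructor <;> nlinarith [mul_nonneg hs0 (sub_nonneg.2 hs1),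
        mul_nonneg (mul_nonneg hs0 (sub_nonneg.2 hs1)) he0, mul_nonneg (sub_nonneg.2 hs1) he0,
        mul_nonneg he0 he0, mul_nonneg (mul_nonneg hs0 hs0) (sub_nonneg.2 hs1),
        mul_nonneg (mul_nonneg (sub_nonneg.2 hs1) (sub_nonneg.2 hs1)) hs0]
  · rw [(cut_right hv2).1, (cut_right hv2).2]
    rcases le_total w 1 with hw | hw
    · rw [(cut_left hw).1]; constructor <;> nlinarith
    rcases le_total w 2 with hw2 | hw2
    · have h2 : (2 - w) ^ 2 ≤ (v - w) ^ 2 := pow_le_pow_left₀ (by linarith) (by linarith) 2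
      have h3 : w ^ 2 ≤ 4 := by nlinarith
      rw [(cut_mid hw hw2).1, show (1 - (w - 1) ^ 2) ^ 2 = (2 - w) ^ 2 * w ^ 2 by ring,
        show (w - v) ^ 2 = (v - w) ^ 2 by ring]
      constructor <;> nlinarith [mul_le_mul_of_nonneg_left h3 (sq_nonneg (2 - w)),
        mul_nonneg (sq_nonneg (2 - w)) (sq_nonneg w)]
    · rw [(cut_right hw2).1]; constructor <;> nlinarith

/-- `0 ≤ f ≤ 1`. -/
theorem cut_mem (u : ℝ) :
    0 ≤ (max 0 (1 - (max 0 (u - 1)) ^ 2)) ^ 2 ∧ (max 0 (1 - (max 0 (u - 1)) ^ 2)) ^ 2 ≤ 1 := by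
  have h0 : 0 ≤ max 0 (1 - (max 0 (u - 1)) ^ 2) := le_max_left _ _
  have h1 : max 0 (1 - (max 0 (u - 1)) ^ 2) ≤ 1 :=
    max_le zero_le_one (by nlinarith [sq_nonneg (max 0 (u - 1))])
  exact ⟨sq_nonneg _, by nlinarith⟩

/-- First differences of `f` over steps of length `≤ 1`: `|f(w) - f(v)| ≤ 8 |w - v|`. -/
theorem cut_sub_le {v w : ℝ} (h : |w - v| ≤ 1) :
    |(max 0 (1 - (max 0 (w - 1)) ^ 2)) ^ 2 - (max 0 (1 - (max 0 (v - 1)) ^ 2)) ^ 2| ≤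
      8 * |w - v| := by
  have ht := cut_taylor v w
  have hD : |-4 * max 0 (v - 1) * max 0 (1 - (max 0 (v - 1)) ^ 2)| ≤ 4 := by
    set t := max 0 (v - 1) with ht
    have ht0 : 0 ≤ t := le_max_left _ _
    have hg0 : 0 ≤ max 0 (1 - t ^ 2) := le_max_left _ _
    have hg1 : max 0 (1 - t ^ 2) ≤ 1 := max_le zero_le_one (by nlinarith)
    rw [show -4 * t * max 0 (1 - t ^ 2) = -(4 * (t * max 0 (1 - t ^ 2))) by ring, abs_neg,
      abs_of_nonneg (by positivity)]
    rcases le_total t 1 with h | h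
    · nlinarith [mul_le_mul h hg1 hg0 zero_le_one]
    · rw [show max 0 (1 - t ^ 2) = 0 from max_eq_left (by nlinarith)]; norm_num
  have h1 : |-4 * max 0 (v - 1) * max 0 (1 - (max 0 (v - 1)) ^ 2) * (w - v)| ≤ 4 * |w - v| := by
    rw [abs_mul]; exact mul_le_mul_of_nonneg_right hD (abs_nonneg _)
  have h2 : (w - v) ^ 2 ≤ |w - v| := by rw [← sq_abs]; nlinarith [abs_nonneg (w - v)]
  set D := -4 * max 0 (v - 1) * max 0 (1 - (max 0 (v - 1)) ^ 2) * (w - v)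
  rw [abs_le] at ht h1 ⊢
  constructor <;> nlinarith [ht.1, ht.2, h1.1, h1.2]

/-- Symmetric second differences of `f`: `|f(u + h) - 2 f(u) + f(u - h)| ≤ 8 h²`. -/
theorem cut_second_le (u h : ℝ) :
    |(max 0 (1 - (max 0 (u + h - 1)) ^ 2)) ^ 2 - 2 * (max 0 (1 - (max 0 (u - 1)) ^ 2)) ^ 2 +
        (max 0 (1 - (max 0 (u - h - 1)) ^ 2)) ^ 2| ≤ 8 * h ^ 2 := by
  have h1 := cut_taylor u (u + h)
  have h2 := cut_taylor u (u - h)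
  rw [show u + h - u = h by ring] at h1
  rw [show u - h - u = -h by ring, neg_sq, mul_neg] at h2
  set D := -4 * max 0 (u - 1) * max 0 (1 - (max 0 (u - 1)) ^ 2) * h
  rw [abs_le] at h1 h2 ⊢
  constructor <;> linarith [h1.1, h1.2, h2.1, h2.2]

section Cyclic

variable {L : ℕ} [NeZero L]

/-- The real form of the cyclic distance is the cast of the natural one. -/
theorem cast_cyc (ω : ZMod L) :
    ((min ω.val (L - ω.val) : ℕ) : ℝ) = min (ω.val : ℝ) ((L : ℝ) - ω.val) := by
  rw [Nat.cast_min, Nat.cast_sub (ZMod.val_le ω)]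

/-- **Trichotomy** of the cyclic distance along `ω - 1, ω, ω + 1` (`L ≥ 4`): the reflection
pattern `(1, 0, 1)` at `ω = 0`, an arithmetic progression of step `±1`, or all three values
`≥ (L - 3)/2` (near the antipode). -/
theorem cyc_trichotomy (hL : 4 ≤ L) (ω : ZMod L) :
    (min ω.val (L - ω.val) = 0 ∧ min (ω + 1).val (L - (ω + 1).val) = 1 ∧
        min (ω - 1).val (L - (ω - 1).val) = 1) ∨
    (∃ d : ℤ, (d = 1 ∨ d = -1) ∧
        ((min (ω + 1).val (L - (ω + 1).val) : ℕ) : ℤ) = (min ω.val (L - ω.val) : ℕ) + d ∧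
        ((min (ω - 1).val (L - (ω - 1).val) : ℕ) : ℤ) = (min ω.val (L - ω.val) : ℕ) - d) ∨
    (L - 3 ≤ 2 * min ω.val (L - ω.val) ∧ L - 3 ≤ 2 * min (ω + 1).val (L - (ω + 1).val) ∧
      L - 3 ≤ 2 * min (ω - 1).val (L - (ω - 1).val)) := by
  haveI : Fact (1 < L) := ⟨by omega⟩
  have hv := ZMod.val_lt ω
  have h1 : (ω + 1).val = (ω.val + 1) % L := by rw [ZMod.val_add, ZMod.val_one]
  have h2 : (ω - 1).val = (ω.val + (L - 1)) % L := by
    rw [sub_eq_add_neg, ZMod.val_add, ZMod.neg_val, if_neg one_ne_zero, ZMod.val_one]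
  rcases Nat.eq_zero_or_pos ω.val with hv0 | hv0
  · left
    rw [h1, h2, hv0, zero_add, zero_add, Nat.mod_eq_of_lt (by omega : 1 < L),
      Nat.mod_eq_of_lt (by omega : L - 1 < L)]
    omega
  rcases lt_or_ge (ω.val + 1) L with hvL | hvL
  · have e1 : (ω + 1).val = ω.val + 1 := by rw [h1, Nat.mod_eq_of_lt hvL]
    have e2 : (ω - 1).val = ω.val - 1 := by
      rw [h2, show ω.val + (L - 1) = (ω.val - 1) + L by omega, Nat.add_mod_right,
        Nat.mod_eq_of_lt (by omega)]
    rw [e1, e2]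
    rcases le_or_gt (2 * ω.val + 2) L with ha | ha
    · exact Or.inr (Or.inl ⟨1, Or.inl rfl, by omega, by omega⟩)
    · rcases le_or_gt (L + 2) (2 * ω.val) with hb | hb
      exacts [Or.inr (Or.inl ⟨-1, Or.inr rfl, by omega, by omega⟩), Or.inr (Or.inr (by omega))]
  · have e1 : (ω + 1).val = 0 := by rw [h1, show ω.val + 1 = L by omega, Nat.mod_self]
    have e2 : (ω - 1).val = L - 2 := by
      rw [h2, show ω.val + (L - 1) = (L - 2) + L by omega, Nat.add_mod_right,
        Nat.mod_eq_of_lt (by omega)]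
    exact Or.inr (Or.inl ⟨-1, Or.inr rfl, by rw [e1]; omega, by rw [e2]; omega⟩)

end Cyclic

section OneCoordinate
variable {L : ℕ} {N : ℕ} {g : ZMod L → ℝ}

/-- `0 ≤ g ≤ 1`. -/
theorem g_mem (hg : ∀ ω : ZMod L, g ω =
      (max 0 (1 - (max 0 (min (ω.val : ℝ) ((L : ℝ) - ω.val) / N - 1)) ^ 2)) ^ 2) (ω : ZMod L) :
    0 ≤ g ω ∧ g ω ≤ 1 := by rw [hg]; exact cut_mem _

variable [NeZero L] (hN : 1 ≤ N) (hg : ∀ ω : ZMod L, g ω =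
  (max 0 (1 - (max 0 (min (ω.val : ℝ) ((L : ℝ) - ω.val) / N - 1)) ^ 2)) ^ 2)
include hg hN

/-- `g = 1` where the cyclic distance is `≤ N`, `g = 0` where it is `≥ 2N`. -/
theorem g_eq_one_zero (ω : ZMod L) :
    (min ω.val (L - ω.val) ≤ N → g ω = 1) ∧ (2 * N ≤ min ω.val (L - ω.val) → g ω = 0) := by
  rw [hg, ← cast_cyc]
  have hN' : (0 : ℝ) < N := by exact_mod_cast hN
  refine ⟨fun h => (cut_left ((div_le_one hN').2 ?_)).1,
    fun h => (cut_right ((le_div_iff₀ hN').2 ?_)).1⟩ <;> exact_mod_cast h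

/-- First differences: `|g(ω + 1) - g(ω)| ≤ 8/N`. -/
theorem g_diff (ω : ZMod L) : |g (ω + 1) - g ω| ≤ 8 / N := by
  rw [hg, hg, ← cast_cyc, ← cast_cyc]
  have hN' : (0 : ℝ) < N := by exact_mod_cast hN
  have h1 : ((min (ω + 1).val (L - (ω + 1).val) : ℕ) : ℝ) ≤ (min ω.val (L - ω.val) : ℕ) + 1 := by
    exact_mod_cast (cyclicAbs_add_le L ω 1).trans (Nat.add_le_add_left cyclicAbs_one_le _)
  have h2 : ((min ω.val (L - ω.val) : ℕ) : ℝ) ≤ (min (ω + 1).val (L - (ω + 1).val) : ℕ) + 1 := by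
    have h := cyclicAbs_add_le L (ω + 1) (-1)
    rw [add_neg_cancel_right, cyclicAbs_neg] at h
    exact_mod_cast h.trans (Nat.add_le_add_left cyclicAbs_one_le _)
  have hd : |((min (ω + 1).val (L - (ω + 1).val) : ℕ) : ℝ) / N -
      ((min ω.val (L - ω.val) : ℕ) : ℝ) / N| ≤ 1 / N := by
    rw [← sub_div, abs_div, abs_of_pos hN', div_le_div_iff_of_pos_right hN', abs_le]
    constructor <;> linarith
  refine (cut_sub_le (hd.trans ((div_le_one hN').2 (by exact_mod_cast hN)))).trans ?_
  rw [div_eq_mul_one_div (8 : ℝ)]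
  exact mul_le_mul_of_nonneg_left hd (by norm_num)

/-- Second differences: `|g(ω + 1) - 2 g(ω) + g(ω - 1)| ≤ 8/N²` (`4N + 3 ≤ L`). -/
theorem g_second (hL : 4 * N + 3 ≤ L) (ω : ZMod L) :
    |g (ω + 1) - 2 * g ω + g (ω - 1)| ≤ 8 / N ^ 2 := by
  have h8 : (0 : ℝ) ≤ 8 / N ^ 2 := by positivity
  rcases cyc_trichotomy (by omega) ω with ⟨h0, h1, h2⟩ | ⟨d, hd, h1, h2⟩ | ⟨h0, h1, h2⟩
  · rw [(g_eq_one_zero hN hg _).1 (by omega), (g_eq_one_zero hN hg _).1 (by omega),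
      (g_eq_one_zero hN hg _).1 (by omega)]
    norm_num; exact h8
  · rw [hg, hg, hg, ← cast_cyc, ← cast_cyc, ← cast_cyc]
    have e1 : ((min (ω + 1).val (L - (ω + 1).val) : ℕ) : ℝ) / N =
        ((min ω.val (L - ω.val) : ℕ) : ℝ) / N + d / N := by
      rw [← add_div]; congr 1; exact_mod_cast h1
    have e2 : ((min (ω - 1).val (L - (ω - 1).val) : ℕ) : ℝ) / N =
        ((min ω.val (L - ω.val) : ℕ) : ℝ) / N - d / N := by
      rw [← sub_div]; congr 1; exact_mod_cast h2
    have hd2 : ((d : ℝ) / N) ^ 2 = 1 / N ^ 2 := by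
      rw [div_pow]; congr 1; rcases hd with rfl | rfl <;> norm_num
    rw [e1, e2]
    refine (cut_second_le _ _).trans (le_of_eq ?_)
    rw [hd2, ← div_eq_mul_one_div]
  · rw [(g_eq_one_zero hN hg _).2 (by omega), (g_eq_one_zero hN hg _).2 (by omega),
      (g_eq_one_zero hN hg _).2 (by omega)]
    norm_num; exact h8

/-- First differences along `±1`. -/
theorem g_diff' {σ : ZMod L} (hσ : σ = 1 ∨ σ = -1) (ω : ZMod L) : |g (ω + σ) - g ω| ≤ 8 / N := by
  rcases hσ with rfl | rfl
  · exact g_diff hN hg ω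
  · have h := g_diff hN hg (ω + -1)
    rwa [neg_add_cancel_right, abs_sub_comm] at h

/-- All four second differences along `±1, ±1`. -/
theorem g_second' (hL : 4 * N + 3 ≤ L) {σ τ : ZMod L} (hσ : σ = 1 ∨ σ = -1)
    (hτ : τ = 1 ∨ τ = -1) (ω : ZMod L) :
    |g (ω + σ + τ) - g (ω + σ) - g (ω + τ) + g ω| ≤ 8 / N ^ 2 := by
  have key : ∀ ω, |g (ω + 1) - 2 * g ω + g (ω + -1)| ≤ 8 / N ^ 2 := fun ω => by
    rw [← sub_eq_add_neg]; exact g_second hN hg hL ω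
  rcases hσ with rfl | rfl <;> rcases hτ with rfl | rfl
  · have h := key (ω + 1); rw [add_neg_cancel_right] at h; convert h using 2; ring
  · rw [← abs_neg]; convert key ω using 2; rw [add_neg_cancel_right]; ring
  · rw [← abs_neg]; convert key ω using 2; rw [neg_add_cancel_right]; ring
  · have h := key (ω + -1); rw [neg_add_cancel_right] at h; convert h using 2; ring

end OneCoordinate

section Product
variable {L : ℕ} {g : ZMod L → ℝ}

/-- Peeling one coordinate off the product. -/
theorem prod_eq_erase_mul (w p : TorusSite 4 L) (μ : Fin 4) (h : ∀ κ, κ ≠ μ → p κ = w κ) :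
    ∏ κ, g (p κ) = (∏ κ ∈ Finset.univ.erase μ, g (w κ)) * g (p μ) := by
  rw [← Finset.prod_erase_mul _ _ (Finset.mem_univ μ)]
  exact congrArg (· * _) (Finset.prod_congr rfl fun κ hκ => by rw [h κ (Finset.ne_of_mem_erase hκ)])

/-- Peeling two distinct coordinates off the product. -/
theorem prod_eq_erase_erase_mul (w p : TorusSite 4 L) {μ ν : Fin 4} (hμν : μ ≠ ν)
    (h : ∀ κ, κ ≠ μ → κ ≠ ν → p κ = w κ) :
    ∏ κ, g (p κ) = (∏ κ ∈ (Finset.univ.erase μ).erase ν, g (w κ)) * g (p ν) * g (p μ) := by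
  rw [← Finset.prod_erase_mul _ _ (Finset.mem_univ μ), ← Finset.prod_erase_mul _ _
    (Finset.mem_erase.2 ⟨hμν.symm, Finset.mem_univ ν⟩)]
  congr 2
  exact Finset.prod_congr rfl fun κ hκ => by
    rw [h κ (Finset.ne_of_mem_erase (Finset.mem_of_mem_erase hκ)) (Finset.ne_of_mem_erase hκ)]

/-- Partial products of factors in `[0, 1]` have modulus `≤ 1`. -/
theorem abs_prod_le_one (hg : ∀ ω, 0 ≤ g ω ∧ g ω ≤ 1) (s : Finset (Fin 4)) (w : TorusSite 4 L) :
    |∏ κ ∈ s, g (w κ)| ≤ 1 := by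
  rw [Finset.abs_prod]
  exact Finset.prod_le_one (fun _ _ => abs_nonneg _) fun κ _ =>
    abs_le.2 ⟨by linarith [(hg (w κ)).1], (hg (w κ)).2⟩

/-- **First differences of the product** along a unit step `± e_μ`. -/
theorem prod_diff (hg : ∀ ω, 0 ≤ g ω ∧ g ω ≤ 1) {a : ℝ}
    (hd : ∀ (σ : ZMod L), (σ = 1 ∨ σ = -1) → ∀ ω, |g (ω + σ) - g ω| ≤ a)
    (w : TorusSite 4 L) (μ : Fin 4) {σ : ZMod L} (hσ : σ = 1 ∨ σ = -1) :
    |(∏ κ, g ((w + Pi.single μ σ : TorusSite 4 L) κ)) - ∏ κ, g (w κ)| ≤ a := by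
  have e1 := prod_eq_erase_mul (g := g) w (w + Pi.single μ σ) μ (fun κ hκ => by simp [hκ])
  rw [e1, prod_eq_erase_mul w w μ (fun κ _ => rfl), ← mul_sub, abs_mul]
  have h2 : |g ((w + Pi.single μ σ : TorusSite 4 L) μ) - g (w μ)| ≤ a := by
    simpa using hd σ hσ (w μ)
  calc _ ≤ 1 * a := mul_le_mul (abs_prod_le_one hg _ w) h2 (abs_nonneg _) zero_le_one
    _ = a := one_mul a

/-- **Second differences of the product** along two unit steps `± e_μ`, `± e_ν` (pure or mixed). -/
theorem prod_second (hg : ∀ ω, 0 ≤ g ω ∧ g ω ≤ 1) {a b : ℝ} (hb : 0 ≤ b)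
    (hd : ∀ (σ : ZMod L), (σ = 1 ∨ σ = -1) → ∀ ω, |g (ω + σ) - g ω| ≤ a)
    (hdd : ∀ (σ τ : ZMod L), (σ = 1 ∨ σ = -1) → (τ = 1 ∨ τ = -1) → ∀ ω,
      |g (ω + σ + τ) - g (ω + σ) - g (ω + τ) + g ω| ≤ b)
    (w : TorusSite 4 L) (μ ν : Fin 4) {σ τ : ZMod L} (hσ : σ = 1 ∨ σ = -1) (hτ : τ = 1 ∨ τ = -1) :
    |(∏ κ, g ((w + Pi.single μ σ + Pi.single ν τ : TorusSite 4 L) κ)) -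
        (∏ κ, g ((w + Pi.single μ σ : TorusSite 4 L) κ)) -
        (∏ κ, g ((w + Pi.single ν τ : TorusSite 4 L) κ)) + ∏ κ, g (w κ)| ≤ b + a ^ 2 := by
  rcases eq_or_ne μ ν with rfl | hμν
  · have e1 := prod_eq_erase_mul (g := g) w (w + Pi.single μ σ + Pi.single μ τ) μ
      (fun κ hκ => by simp [hκ])
    have e2 := prod_eq_erase_mul (g := g) w (w + Pi.single μ σ) μ (fun κ hκ => by simp [hκ])
    have e3 := prod_eq_erase_mul (g := g) w (w + Pi.single μ τ) μ (fun κ hκ => by simp [hκ])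
    rw [e1, e2, e3, prod_eq_erase_mul w w μ (fun κ _ => rfl)]
    simp only [Pi.add_apply, Pi.single_eq_same]
    calc _ = |(∏ κ ∈ Finset.univ.erase μ, g (w κ)) *
          (g (w μ + σ + τ) - g (w μ + σ) - g (w μ + τ) + g (w μ))| := by ring_nf
      _ ≤ 1 * b := by
          rw [abs_mul]
          exact mul_le_mul (abs_prod_le_one hg _ w) (hdd σ τ hσ hτ (w μ)) (abs_nonneg _) zero_le_one
      _ ≤ b + a ^ 2 := by nlinarith
  · have e1 := prod_eq_erase_erase_mul (g := g) w (w + Pi.single μ σ + Pi.single ν τ) hμν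
      (fun κ h1 h2 => by simp [h1, h2])
    have e2 := prod_eq_erase_erase_mul (g := g) w (w + Pi.single μ σ) hμν
      (fun κ h1 _ => by simp [h1])
    have e3 := prod_eq_erase_erase_mul (g := g) w (w + Pi.single ν τ) hμν
      (fun κ _ h2 => by simp [h2])
    rw [e1, e2, e3, prod_eq_erase_erase_mul w w hμν (fun κ _ _ => rfl)]
    have h3 : |g (w ν + τ) - g (w ν)| ≤ a := hd τ hτ (w ν)
    simp only [Pi.add_apply, Pi.single_eq_same, Pi.single_eq_of_ne hμν.symm,
      Pi.single_eq_of_ne hμν, add_zero]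
    calc _ = |(∏ κ ∈ (Finset.univ.erase μ).erase ν, g (w κ)) *
          ((g (w ν + τ) - g (w ν)) * (g (w μ + σ) - g (w μ)))| := by ring_nf
      _ ≤ 1 * (a * a) := by
          rw [abs_mul, abs_mul]
          exact mul_le_mul (abs_prod_le_one hg _ w) (mul_le_mul h3 (hd σ hσ (w μ)) (abs_nonneg _)
            ((abs_nonneg _).trans h3)) (by positivity) zero_le_one
      _ ≤ b + a ^ 2 := by nlinarith

end Product
end CommutatorBound

open CommutatorBound in
/-- **Summary (registered auxiliary stub `stub_commutatorBoundAux`).**  The product cutoff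
`χ(z) = ∏_ν f(c_ν(z - x)/N)`, `f(u) = (max 0 (1 - (max 0 (u - 1))²))²`, of scale `N ≥ 1` centred at
`x` on the four-torus of side `L ≥ 4N + 3` is `1` on the ball of radius `N` about `x`, `0` off the
ball of radius `2N`, with unit-step first differences `≤ 8/N`, second differences `≤ 72/N²`. -/
theorem stub_commutatorBoundAux : ∀ (L N : ℕ) [NeZero L], 1 ≤ N → 4 * N + 3 ≤ L →
    ∀ (x : TorusSite 4 L) (χ : TorusSite 4 L → ℝ),
    (∀ z, χ z = ∏ ν : Fin 4, (max 0 (1 - (max 0 ((min ((z - x) ν).val (L - ((z - x) ν).val) : ℝ) /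
      (N : ℝ) - 1)) ^ 2)) ^ 2) →
    (∀ z, torusDist x z ≤ N → χ z = 1) ∧ (∀ z, 2 * N ≤ torusDist x z → χ z = 0) ∧
    (∀ (z : TorusSite 4 L) (μ : Fin 4) (σ : ZMod L), (σ = 1 ∨ σ = -1) →
      |χ (z + Pi.single μ σ) - χ z| ≤ 8 / N) ∧
    (∀ (z : TorusSite 4 L) (μ ν : Fin 4) (σ τ : ZMod L), (σ = 1 ∨ σ = -1) → (τ = 1 ∨ τ = -1) →
      |χ (z + Pi.single μ σ + Pi.single ν τ) - χ (z + Pi.single μ σ) - χ (z + Pi.single ν τ) +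
        χ z| ≤ 72 / (N : ℝ) ^ 2) := by
  intro L N _ hN hL x χ hχ
  set g : ZMod L → ℝ := fun ω =>
    (max 0 (1 - (max 0 (min (ω.val : ℝ) ((L : ℝ) - ω.val) / N - 1)) ^ 2)) ^ 2 with hg
  have hg' : ∀ ω : ZMod L, g ω =
      (max 0 (1 - (max 0 (min (ω.val : ℝ) ((L : ℝ) - ω.val) / N - 1)) ^ 2)) ^ 2 := fun ω => rfl
  have hχ' : ∀ w, χ w = ∏ ν, g ((w - x) ν) := fun w => hχ w
  have hd : ∀ (σ : ZMod L), (σ = 1 ∨ σ = -1) → ∀ ω, |g (ω + σ) - g ω| ≤ 8 / N :=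
    fun σ hσ ω => g_diff' hN hg' hσ ω
  have hdd : ∀ (σ τ : ZMod L), (σ = 1 ∨ σ = -1) → (τ = 1 ∨ τ = -1) → ∀ ω,
      |g (ω + σ + τ) - g (ω + σ) - g (ω + τ) + g ω| ≤ 8 / N ^ 2 :=
    fun σ τ hσ hτ ω => g_second' hN hg' hL hσ hτ ω
  refine ⟨fun z hz => ?_, fun z hz => ?_, fun z μ σ hσ => ?_, fun z μ ν σ τ hσ hτ => ?_⟩
  · rw [hχ']
    refine Finset.prod_eq_one fun ν _ => (g_eq_one_zero hN hg' _).1 (le_trans ?_ hz)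
    rw [torusDist_comm']
    exact Finset.le_sup (f := fun i => min ((z - x) i).val (L - ((z - x) i).val))
      (Finset.mem_univ ν)
  · rw [torusDist_comm'] at hz
    obtain ⟨ν, -, hν⟩ := Finset.exists_mem_eq_sup Finset.univ ⟨(0 : Fin 4), Finset.mem_univ _⟩
      (fun i => min ((z - x) i).val (L - ((z - x) i).val))
    rw [hχ']
    exact Finset.prod_eq_zero (Finset.mem_univ ν) ((g_eq_one_zero hN hg' _).2 (hν ▸ hz))
  · rw [hχ', hχ', add_sub_right_comm]
    exact prod_diff (g_mem hg') hd (z - x) μ hσ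
  · rw [hχ', hχ', hχ', hχ', add_sub_right_comm, add_sub_right_comm, add_sub_right_comm]
    have hN' : (0 : ℝ) < N := by exact_mod_cast hN
    refine (prod_second (g_mem hg') (by positivity) hd hdd (z - x) μ ν hσ hτ).trans ?_
    rw [div_pow, ← add_div, div_le_div_iff_of_pos_right (by positivity)]
    norm_num

end Summit.QuantumFields.QCD.Cruxes.SmallFieldUltracontractivity.PointCentredAxialParabolic

end
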